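import Literature.Dynamics.SymbolicDynamics.DistortionSkeleton
import HarnessLib

/-!
# Completing the `↓`-layer of a box by level rays

The first surgery step of the gluing construction for the distortion subshift
(Gangloff–Sablik Prop. 31, "completing the curves … into infinite curves … straight"): given an
admissible `↓`-set `N` (`IsDeltaSet`, `DistortionSkeleton.lean`) and a box
`⟦W, E⟧ × ⟦Bo, T⟧`, the set `boxCompl N W E Bo T` keeps `N` inside the box and continues every
chain leaving the box by a LEVEL ray: a `↓` on the east column `E` continues eastwards on its
row, a `↓` on the west column westwards; a chain leaving through the top at column `i` (a *top
exit*: `(i, T) ∈ N`, `(i+1, T) ∉ N`, forced to continue at `(i+1, T+1)`) climbs diagonally to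
column `E + 1` and then runs level on row `T + 1 + E - i`; symmetrically a chain entering through
the bottom (*bottom exit* at `i`: `(i, Bo) ∈ N`, `(i-1, Bo) ∉ N`) comes diagonally from column
`W - 1` and, further west, level on row `Bo - 1 - (i - W)`. Outside the columns of the box the
completed set is thus level, with row sets `rowsE` (east) and `rowsW` (west).

* `IsDeltaSet.boxCompl` — **the completion obeys the rules**;
* `mem_boxCompl_of_lt` / `mem_boxCompl_of_gt` / `mem_boxCompl_box` — its description by regions;
* `rowsE_bounds` / `rowsW_bounds` — all its cells outside the box columns lie in rows
  `⟦Bo - 1 - (E - W), T + 1 + (E - W)⟧`.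

## References

* S. Gangloff, M. Sablik, *Quantified block gluing for multidimensional subshifts of finite type:
  aperiodicity and entropy*, J. Anal. Math. 144 (2021), §5.4.2, proof of Prop. 31
  (arXiv:1706.01627).
-/

namespace Literature.Dynamics.SymbolicDynamics.Distortion

variable {N : Set (ℤ × ℤ)} {W E Bo T : ℤ}

/-! ### Exits and the completed set -/

/-- A **top exit** of the box at column `i`: the chain through `(i, T) ∈ N` leaves the box
upwards (`(i+1, T) ∉ N` forces `(i+1, T+1) ∈ N`). [cite: GangloffSablik2021, §5.4.2 (arXiv numbering)] -/
def TopExit (N : Set (ℤ × ℤ)) (W E T i : ℤ) : Prop :=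
  W ≤ i ∧ i < E ∧ (i, T) ∈ N ∧ (i + 1, T) ∉ N

/-- A **bottom exit** at column `i`: the chain through `(i, Bo) ∈ N` enters the box from below
(`(i-1, Bo) ∉ N` forces `(i-1, Bo-1) ∈ N`). [cite: GangloffSablik2021, §5.4.2 (arXiv numbering)] -/
def BotExit (N : Set (ℤ × ℤ)) (W E Bo i : ℤ) : Prop :=
  W < i ∧ i ≤ E ∧ (i, Bo) ∈ N ∧ (i - 1, Bo) ∉ N

/-- Rows of the completed set east of the box (columns `> E`): the `↓` of the east column, and
one row `T + 1 + E - i` per top exit `i`. [cite: GangloffSablik2021, §5.4.2 (arXiv numbering)] -/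
def rowsE (N : Set (ℤ × ℤ)) (W E Bo T : ℤ) : Set ℤ :=
  {ρ | (Bo ≤ ρ ∧ ρ ≤ T ∧ (E, ρ) ∈ N) ∨ ∃ i, TopExit N W E T i ∧ ρ = T + 1 + E - i}

/-- Rows of the completed set west of the box (columns `< W`). [cite: GangloffSablik2021, §5.4.2 (arXiv numbering)] -/
def rowsW (N : Set (ℤ × ℤ)) (W E Bo T : ℤ) : Set ℤ :=
  {ρ | (Bo ≤ ρ ∧ ρ ≤ T ∧ (W, ρ) ∈ N) ∨ ∃ i, BotExit N W E Bo i ∧ ρ = Bo - 1 - (i - W)}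

/-- **The level completion of the box `⟦W, E⟧ × ⟦Bo, T⟧` of `N`.**
[cite: GangloffSablik2021, §5.4.2 (arXiv numbering), proof of Prop. 31] -/
def boxCompl (N : Set (ℤ × ℤ)) (W E Bo T : ℤ) : Set (ℤ × ℤ) :=
  {c | (c.1 < W ∧ c.2 ∈ rowsW N W E Bo T) ∨ (E < c.1 ∧ c.2 ∈ rowsE N W E Bo T) ∨
    (W ≤ c.1 ∧ c.1 ≤ E ∧
      ((Bo ≤ c.2 ∧ c.2 ≤ T ∧ c ∈ N) ∨ (∃ i, TopExit N W E T i ∧ i < c.1 ∧ c.2 = T + (c.1 - i)) ∨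
        (∃ i, BotExit N W E Bo i ∧ c.1 < i ∧ c.2 = Bo - (i - c.1))))}

/-! ### Description by regions -/

section Regions

variable (hWE : W ≤ E)
include hWE

/-- [folklore] -/
theorem mem_boxCompl_of_lt {i j : ℤ} (h : i < W) :
    (i, j) ∈ boxCompl N W E Bo T ↔ j ∈ rowsW N W E Bo T := by
  simp only [boxCompl, Set.mem_setOf_eq]
  constructor
  · rintro (⟨-, h1⟩ | ⟨h1, -⟩ | ⟨h1, -⟩)
    · exact h1
    · omega
    · omega
  · exact fun h1 => Or.inl ⟨h, h1⟩

/-- [folklore] -/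
theorem mem_boxCompl_of_gt {i j : ℤ} (h : E < i) :
    (i, j) ∈ boxCompl N W E Bo T ↔ j ∈ rowsE N W E Bo T := by
  simp only [boxCompl, Set.mem_setOf_eq]
  constructor
  · rintro (⟨h1, -⟩ | ⟨-, h1⟩ | ⟨-, h1, -⟩)
    · omega
    · exact h1
    · omega
  · exact fun h1 => Or.inr (Or.inl ⟨h, h1⟩)

omit hWE in
/-- [folklore] -/
theorem mem_boxCompl_mid {i j : ℤ} (h1 : W ≤ i) (h2 : i ≤ E) :
    (i, j) ∈ boxCompl N W E Bo T ↔
      (Bo ≤ j ∧ j ≤ T ∧ (i, j) ∈ N) ∨ (∃ i₀, TopExit N W E T i₀ ∧ i₀ < i ∧ j = T + (i - i₀)) ∨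
        ∃ i₀, BotExit N W E Bo i₀ ∧ i < i₀ ∧ j = Bo - (i₀ - i) := by
  simp only [boxCompl, Set.mem_setOf_eq]
  constructor
  · rintro (⟨h3, -⟩ | ⟨h3, -⟩ | ⟨-, -, h3⟩)
    · omega
    · omega
    · exact h3
  · exact fun h3 => Or.inr (Or.inr ⟨h1, h2, h3⟩)

omit hWE in
/-- Inside the box the completion is `N`. [cite: GangloffSablik2021, §5.4.2 (arXiv numbering)] -/
theorem mem_boxCompl_box {i j : ℤ} (h1 : W ≤ i) (h2 : i ≤ E) (h3 : Bo ≤ j) (h4 : j ≤ T) :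
    (i, j) ∈ boxCompl N W E Bo T ↔ (i, j) ∈ N := by
  rw [mem_boxCompl_mid h1 h2]
  constructor
  · rintro (⟨-, -, h⟩ | ⟨i₀, -, hi, hc⟩ | ⟨i₀, -, hi, hc⟩)
    · exact h
    · exfalso; omega
    · exfalso; omega
  · exact fun h => Or.inl ⟨h3, h4, h⟩

omit hWE in
/-- Above the box: the top diagonals. [cite: GangloffSablik2021, §5.4.2 (arXiv numbering)] -/
theorem mem_boxCompl_top (hBT : Bo ≤ T) {i j : ℤ} (h1 : W ≤ i) (h2 : i ≤ E) (h3 : T < j) :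
    (i, j) ∈ boxCompl N W E Bo T ↔ ∃ i₀, TopExit N W E T i₀ ∧ i₀ < i ∧ j = T + (i - i₀) := by
  rw [mem_boxCompl_mid h1 h2]
  constructor
  · rintro (⟨-, h, -⟩ | h | ⟨i₀, -, hi, hc⟩)
    · exfalso; omega
    · exact h
    · exfalso; omega
  · exact fun h => Or.inr (Or.inl h)

omit hWE in
/-- Below the box: the bottom diagonals. [cite: GangloffSablik2021, §5.4.2 (arXiv numbering)] -/
theorem mem_boxCompl_bot (hBT : Bo ≤ T) {i j : ℤ} (h1 : W ≤ i) (h2 : i ≤ E) (h3 : j < Bo) :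
    (i, j) ∈ boxCompl N W E Bo T ↔ ∃ i₀, BotExit N W E Bo i₀ ∧ i < i₀ ∧ j = Bo - (i₀ - i) := by
  rw [mem_boxCompl_mid h1 h2]
  constructor
  · rintro (⟨h, -, -⟩ | ⟨i₀, -, hi, hc⟩ | h)
    · exfalso; omega
    · exfalso; omega
    · exact h
  · exact fun h => Or.inr (Or.inr h)

end Regions

/-! ### Facts about exits -/

/-- Two top exits are never in consecutive columns. [cite: GangloffSablik2021, §5.4.2 (arXiv numbering)] -/
theorem TopExit.ne_add_one {i i' : ℤ} (h : TopExit N W E T i) (h' : TopExit N W E T i') :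
    i' ≠ i + 1 := by
  rintro rfl
  exact h.2.2.2 h'.2.2.1

/-- [cite: GangloffSablik2021, §5.4.2 (arXiv numbering)] -/
theorem BotExit.ne_add_one {i i' : ℤ} (h : BotExit N W E Bo i) (h' : BotExit N W E Bo i') :
    i' ≠ i + 1 := by
  rintro rfl
  exact h'.2.2.2 (by rw [add_sub_cancel_right]; exact h.2.2.1)

/-- [folklore] -/
theorem mem_of_eq {i j i' j' : ℤ} (h : (i, j) ∈ N) (hi : i' = i) (hj : j' = j) : (i', j') ∈ N := by
  subst hi hj; exact h

/-- [folklore] -/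
theorem not_mem_of_eq {i j i' j' : ℤ} (h : (i, j) ∉ N) (hi : i' = i) (hj : j' = j) : (i', j') ∉ N := by
  subst hi hj; exact h

variable (hN : IsDeltaSet N)
include hN

/-- No two rows of `rowsE` are adjacent. [cite: GangloffSablik2021, §5.4.2 (arXiv numbering)] -/
theorem rowsE_isolated {ρ : ℤ} (h : ρ ∈ rowsE N W E Bo T) : ρ - 1 ∉ rowsE N W E Bo T := by
  rintro (⟨h1, h2, h3⟩ | ⟨i', hi', he'⟩) <;> rcases h with ⟨g1, g2, g3⟩ | ⟨i, hi, he⟩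
  · exact hN.below E ρ g3 h3
  · have := hi.2.1; omega
  · have := hi'.2.1; omega
  · exact hi.ne_add_one hi' (by omega)

/-- [cite: GangloffSablik2021, §5.4.2 (arXiv numbering)] -/
theorem rowsW_isolated {ρ : ℤ} (h : ρ ∈ rowsW N W E Bo T) : ρ - 1 ∉ rowsW N W E Bo T := by
  rintro (⟨h1, h2, h3⟩ | ⟨i', hi', he'⟩) <;> rcases h with ⟨g1, g2, g3⟩ | ⟨i, hi, he⟩
  · exact hN.below W ρ g3 h3
  · have := hi.1; omega
  · have := hi'.1; omega
  · exact hi.ne_add_one hi' (by omega)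

/-! ### The completion obeys the rules -/

/-- Rule 1: no `↓` directly above a `↓`. [cite: GangloffSablik2021, §5.4.2 (arXiv numbering), proof of Prop. 31] -/
theorem boxCompl_below (hWE : W ≤ E) (hBT : Bo ≤ T) (i j : ℤ) (h : (i, j) ∈ boxCompl N W E Bo T) :
    (i, j - 1) ∉ boxCompl N W E Bo T := by
  intro h'
  rcases lt_or_ge i W with hi | hi
  · rw [mem_boxCompl_of_lt hWE hi] at h h'
    exact rowsW_isolated hN h h'
  rcases lt_or_ge E i with hi' | hi'
  · rw [mem_boxCompl_of_gt hWE hi'] at h h'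
    exact rowsE_isolated hN h h'
  -- middle columns
  rcases (mem_boxCompl_mid hi hi').mp h with ⟨h1, h2, h3⟩ | ⟨i₀, hx, hlt, hj⟩ | ⟨i₀, hx, hlt, hj⟩
  · -- data cell
    rcases lt_or_ge (j - 1) Bo with hb | hb
    · obtain ⟨i₁, hx1, hlt1, hj1⟩ := (mem_boxCompl_bot hBT hi hi' hb).mp h'
      have hj0 : j = Bo := by omega
      have hi1 : i₁ = i + 1 := by omega
      exact hx1.2.2.2 (mem_of_eq h3 (by omega) hj0.symm)
    · exact hN.below i j h3 ((mem_boxCompl_box hi hi' hb (by omega)).mp h')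
  · -- top diagonal
    have hi₀ := hx.2.1
    rcases lt_or_ge T (j - 1) with ht | ht
    · obtain ⟨i₁, hx1, hlt1, hj1⟩ := (mem_boxCompl_top hBT hi hi' ht).mp h'
      exact hx.ne_add_one hx1 (by omega)
    · have hjT : j - 1 = T := by omega
      have hii : i = i₀ + 1 := by omega
      have := (mem_boxCompl_box hi hi' (by omega) (by omega)).mp h'
      exact hx.2.2.2 (mem_of_eq this hii.symm hjT.symm)
  · -- bottom diagonal
    obtain ⟨i₁, hx1, hlt1, hj1⟩ := (mem_boxCompl_bot hBT hi hi' (by omega)).mp h'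
    exact hx.ne_add_one hx1 (by omega)

/-- Rule 2: `(i+1, j) ∈ C`, `(i, j) ∉ C` force `(i, j-1) ∈ C`. [cite: GangloffSablik2021, §5.4.2 (arXiv numbering), proof of Prop. 31] -/
theorem boxCompl_left (hWE : W ≤ E) (hBT : Bo ≤ T) (i j : ℤ) (h1 : (i + 1, j) ∈ boxCompl N W E Bo T)
    (h2 : (i, j) ∉ boxCompl N W E Bo T) : (i, j - 1) ∈ boxCompl N W E Bo T := by
  rcases (show i + 1 < W ∨ i + 1 = W ∨ (W ≤ i ∧ i + 1 ≤ E) ∨ i = E ∨ E < i by omega) with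
    hi | hi | ⟨hi, hi'⟩ | hi | hi
  · -- both west: level
    rw [mem_boxCompl_of_lt hWE hi] at h1
    exact absurd ((mem_boxCompl_of_lt hWE (show i < W by omega)).mpr h1) h2
  · -- column `i + 1 = W`
    rcases (mem_boxCompl_mid (N := N) (Bo := Bo) (T := T) (show W ≤ i + 1 by omega)
        (show i + 1 ≤ E by omega)).mp h1 with ⟨g1, g2, g3⟩ | ⟨i₀, hx, hlt, hj⟩ | ⟨i₀, hx, hlt, hj⟩
    · exact absurd ((mem_boxCompl_of_lt hWE (show i < W by omega)).mpr
        (Or.inl ⟨g1, g2, mem_of_eq g3 hi.symm rfl⟩)) h2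
    · have := hx.1; exfalso; omega
    · rw [mem_boxCompl_of_lt hWE (show i < W by omega)]
      exact Or.inr ⟨i₀, hx, by omega⟩
  · -- both middle
    have hm1 : W ≤ i + 1 := by omega
    rcases (mem_boxCompl_mid hm1 hi').mp h1 with ⟨g1, g2, g3⟩ | ⟨i₀, hx, hlt, hj⟩ | ⟨i₀, hx, hlt, hj⟩
    · -- data at `(i+1, j)`; `(i, j) ∉ N`
      have hij : (i, j) ∉ N := fun h => h2 ((mem_boxCompl_box hi (by omega) g1 g2).mpr h)
      have h3 := hN.left i j g3 hij
      rcases lt_or_ge (j - 1) Bo with hb | hb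
      · rw [mem_boxCompl_bot hBT hi (by omega) hb]
        have hjB : j = Bo := by omega
        refine ⟨i + 1, ⟨by omega, hi', mem_of_eq g3 rfl hjB.symm, ?_⟩, by omega, by omega⟩
        exact not_mem_of_eq hij (by omega) hjB.symm
      · exact (mem_boxCompl_box hi (by omega) hb (by omega)).mpr h3
    · -- top diagonal at `(i+1, j)`
      rcases lt_or_eq_of_le (show i₀ ≤ i by omega) with hlt' | heq
      · rw [mem_boxCompl_top hBT hi (by omega) (by omega)]
        exact ⟨i₀, hx, hlt', by omega⟩
      · subst heq
        rw [mem_boxCompl_box hi (by omega) (by omega) (by omega)]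
        exact mem_of_eq hx.2.2.1 rfl (by omega)
    · -- bottom diagonal at `(i+1, j)`
      rw [mem_boxCompl_bot hBT hi (by omega) (by omega)]
      exact ⟨i₀, hx, by omega, by omega⟩
  · -- `i = E`, `i + 1 = E + 1` east
    subst hi
    rcases (mem_boxCompl_of_gt hWE (show i < i + 1 by omega)).mp h1 with ⟨g1, g2, g3⟩ | ⟨i₀, hx, hj⟩
    · exact absurd ((mem_boxCompl_box hWE le_rfl g1 g2).mpr g3) h2
    · have := hx.2.1
      rw [mem_boxCompl_top hBT hWE le_rfl (by omega)]
      exact ⟨i₀, hx, hx.2.1, by omega⟩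
  · -- both east: level
    rw [mem_boxCompl_of_gt hWE (show E < i + 1 by omega)] at h1
    exact absurd ((mem_boxCompl_of_gt hWE hi).mpr h1) h2

/-- Rule 3: `(i, j) ∈ C`, `(i+1, j) ∉ C` force `(i+1, j+1) ∈ C`. [cite: GangloffSablik2021, §5.4.2 (arXiv numbering), proof of Prop. 31] -/
theorem boxCompl_right (hWE : W ≤ E) (hBT : Bo ≤ T) (i j : ℤ) (h1 : (i, j) ∈ boxCompl N W E Bo T)
    (h2 : (i + 1, j) ∉ boxCompl N W E Bo T) : (i + 1, j + 1) ∈ boxCompl N W E Bo T := by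
  rcases (show i + 1 < W ∨ i + 1 = W ∨ (W ≤ i ∧ i + 1 ≤ E) ∨ i = E ∨ E < i by omega) with
    hi | hi | ⟨hi, hi'⟩ | hi | hi
  · rw [mem_boxCompl_of_lt hWE (show i < W by omega)] at h1
    exact absurd ((mem_boxCompl_of_lt hWE hi).mpr h1) h2
  · -- `i = W - 1`
    rcases (mem_boxCompl_of_lt hWE (show i < W by omega)).mp h1 with ⟨g1, g2, g3⟩ | ⟨i₀, hx, hj⟩
    · exact absurd ((mem_boxCompl_box (show W ≤ i + 1 by omega) (by omega) g1 g2).mpr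
        (mem_of_eq g3 hi rfl)) h2
    · have := hx.1
      rw [mem_boxCompl_bot hBT (by omega) (by omega) (by omega)]
      exact ⟨i₀, hx, by omega, by omega⟩
  · -- both middle
    rcases (mem_boxCompl_mid hi (by omega)).mp h1 with ⟨g1, g2, g3⟩ | ⟨i₀, hx, hlt, hj⟩ | ⟨i₀, hx, hlt, hj⟩
    · have hij : (i + 1, j) ∉ N := fun h => h2 ((mem_boxCompl_box (by omega) hi' g1 g2).mpr h)
      have h3 := hN.right i j g3 hij
      rcases lt_or_ge T (j + 1) with ht | ht
      · rw [mem_boxCompl_top hBT (by omega) hi' ht]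
        have hjT : j = T := by omega
        exact ⟨i, ⟨hi, by omega, mem_of_eq g3 rfl hjT.symm, not_mem_of_eq hij rfl hjT.symm⟩,
          by omega, by omega⟩
      · exact (mem_boxCompl_box (by omega) hi' (by omega) ht).mpr h3
    · rw [mem_boxCompl_top hBT (by omega) hi' (by omega)]
      exact ⟨i₀, hx, by omega, by omega⟩
    · rcases lt_or_eq_of_le (show i + 1 ≤ i₀ by omega) with hlt' | heq
      · rw [mem_boxCompl_bot hBT (by omega) hi' (by omega)]
        exact ⟨i₀, hx, hlt', by omega⟩
      · rw [mem_boxCompl_box (by omega) hi' (by omega) (by omega)]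
        exact mem_of_eq hx.2.2.1 heq (by omega)
  · -- `i = E`
    subst hi
    rcases (mem_boxCompl_mid hWE le_rfl).mp h1 with ⟨g1, g2, g3⟩ | ⟨i₀, hx, hlt, hj⟩ | ⟨i₀, hx, hlt, hj⟩
    · exact absurd ((mem_boxCompl_of_gt hWE (show i < i + 1 by omega)).mpr (Or.inl ⟨g1, g2, g3⟩)) h2
    · rw [mem_boxCompl_of_gt hWE (show i < i + 1 by omega)]
      exact Or.inr ⟨i₀, hx, by omega⟩
    · have := hx.2.1; exfalso; omega
  · rw [mem_boxCompl_of_gt hWE hi] at h1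
    exact absurd ((mem_boxCompl_of_gt hWE (show E < i + 1 by omega)).mpr h1) h2

/-- **The level completion of a box of an admissible `↓`-set obeys the rules.**
[cite: GangloffSablik2021, §5.4.2 (arXiv numbering), proof of Prop. 31] -/
theorem IsDeltaSet.boxCompl (hWE : W ≤ E) (hBT : Bo ≤ T) : IsDeltaSet (boxCompl N W E Bo T) :=
  ⟨boxCompl_below hN hWE hBT, boxCompl_left hN hWE hBT, boxCompl_right hN hWE hBT⟩

omit hN in
/-- The rows used east of the box. [folklore] -/
theorem rowsE_bounds (hWE : W ≤ E) (hBT : Bo ≤ T) {ρ : ℤ} (h : ρ ∈ rowsE N W E Bo T) :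
    Bo ≤ ρ ∧ ρ ≤ T + 1 + (E - W) := by
  rcases h with ⟨h1, h2, -⟩ | ⟨i, hi, rfl⟩
  · constructor <;> omega
  · have := hi.1; have := hi.2.1; constructor <;> omega

omit hN in
/-- The rows used west of the box. [folklore] -/
theorem rowsW_bounds (hWE : W ≤ E) (hBT : Bo ≤ T) {ρ : ℤ} (h : ρ ∈ rowsW N W E Bo T) :
    Bo - 1 - (E - W) ≤ ρ ∧ ρ ≤ T := by
  rcases h with ⟨h1, h2, -⟩ | ⟨i, hi, rfl⟩
  · constructor <;> omega
  · have := hi.1; have := hi.2.1; constructor <;> omega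

omit hN in
/-- All cells of the completion lie in rows `⟦Bo - 1 - (E - W), T + 1 + (E - W)⟧`. [folklore] -/
theorem boxCompl_row_bounds (hWE : W ≤ E) (hBT : Bo ≤ T) {i j : ℤ} (h : (i, j) ∈ boxCompl N W E Bo T) :
    Bo - 1 - (E - W) ≤ j ∧ j ≤ T + 1 + (E - W) := by
  rcases lt_or_ge i W with hc | hc
  · have := rowsW_bounds hWE hBT ((mem_boxCompl_of_lt hWE hc).mp h)
    constructor <;> omega
  rcases lt_or_ge E i with hc' | hc'
  · have := rowsE_bounds hWE hBT ((mem_boxCompl_of_gt hWE hc').mp h)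
    constructor <;> omega
  rcases (mem_boxCompl_mid hc hc').mp h with ⟨h1, h2, -⟩ | ⟨i₀, hi, hlt, hj⟩ | ⟨i₀, hi, hlt, hj⟩
  · constructor <;> omega
  · have := hi.1; have := hi.2.1; constructor <;> omega
  · have := hi.1; have := hi.2.1; constructor <;> omega

end Literature.Dynamics.SymbolicDynamics.Distortion
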